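import Summits.AtomisticToContinuum.BoseEinsteinCondensation.Theorems.BECCutLineWeakDisorderWitnessTransferOccupationThreeDimAux
import Summits.AtomisticToContinuum.BoseEinsteinCondensation.Theorems.BECCutLineWeakDisorderWitnessTransferOccupationThreeDimAux2
import Summits.AtomisticToContinuum.BoseEinsteinCondensation.Theorems.BECCutLineWeakDisorderWitnessTransferOccupationThreeDimAux3
import Literature.Probability.Moments.PaleyZygmund
import HarnessLib

/-!
# Route BECCutLineWeakDisorder — `WitnessTransfer`, (S8): the three-dimensional occupation
# estimate at a coincidence point

Support file (does not close the item) for item stmt-AtomisticToContinuum-14978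
(`Summit.AtomisticToContinuum.BoseEinsteinCondensation.Theses.BECCutLineWeakDisorder`, decl
`WitnessTransfer`): stub (S8) `stub_threeDim_occupation_pz` of line `Sketch`. For two world-lines
`Bⁱ, Bʲ` (`i ≠ j`) of the Feynman–Kac sample space started at the same point, `T > 0`, a radial
`g ≥ 0` supported in `r ≤ √T` with `m = ∫ g(|w|)/|w| dw ∈ (0, ∞)` and the potential bound
`∫ g(|w|)/|w − x| dw ≤ K m` for a.e. `x`, the occupation functional satisfies
`P(∫_{(0,T]} g(|Bⁱ_s − Bʲ_s|) ds ≥ m/1000) ≥ 1/(1000 K)`.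

Assembly of the three support files: the pair difference `Z = Bⁱ − Bʲ` is a speed-`4` Brownian
motion in `ℝ³` with the Markov factorisation (`…OccupationThreeDimAux`), its transition density
has Green function `≍ 1/|w|` on `|w| ≤ √T` (`…Aux2`: `c₃/|w| ≤ ∫_{(0,T]} q_s(|w|) ds`,
`∫_{(0,∞)} q_s(|w|) ds ≤ C₃/|w|`, `c₃ ≥ 2/1000`, `C₃ ≤ 125 c₃`), and the moments of the
occupation functional of such a process are `c₃ m ≤ E J ≤ C₃ m`, `E[J²] ≤ 2 C₃ K m E J`
(`…Aux3`); here: the first-moment bounds (`lintegral_occupation_ge`, `lintegral_occupation_le`),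
the Paley–Zygmund step `P(J ≥ m/1000) ≥ (E J − m/1000)²/E[J²] ≥ c₃/(8 C₃ K) ≥ 1/(1000 K)`
(`occupation_pz_of_kernel_bounds`, with `Literature.Probability.Moments.paleyZygmund`), and the
stub.

## References

* R. E. A. C. Paley, A. Zygmund, Proc. Camb. Phil. Soc. 28 (1932) 266–272.
* K. L. Chung, Z. Zhao, *From Brownian Motion to Schrödinger's Equation* (1995), §3.2, (1.11).
  [ChungZhao1995]
-/

noncomputable section

open MeasureTheory ProbabilityTheory Filter Set Metric
open scoped ENNReal NNReal Topology

namespace Summit.AtomisticToContinuum.BoseEinsteinCondensation.Theorems.CutLineWitness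

open Literature.MathematicalPhysics.QuantumManyBody.BoseGas
open Literature.Probability.Process

section Abstract

variable {Ω : Type*} [MeasurableSpace Ω] {P : Measure Ω} {Z : ℝ≥0 → Ω → Space}
  {ρ : ℝ → ℝ → ℝ≥0∞} {g : ℝ → ℝ≥0∞}

/-! ### First-moment bounds -/

/-- **Lower bound on the first moment**: if `c/|w| ≤ ∫_{(0,T]} ρ_s(|w|) ds` for `0 < |w| ≤ √T`
and `g(r) = 0` for `r > √T`, then `c m ≤ E J`. [folklore] -/
theorem lintegral_occupation_ge [SFinite P] (hZ : Measurable fun p : Ω × ℝ≥0 => Z p.2 p.1)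
    (hg : Measurable g) (hρ : Measurable fun p : ℝ × ℝ => ρ p.1 p.2)
    (hlaw : ∀ t : ℝ≥0, t ≠ 0 → ∀ F : Space → ℝ≥0∞, Measurable F →
      ∫⁻ ω, F (Z t ω) ∂P = ∫⁻ w, ρ t ‖w‖ * F w) {T : ℝ}
    (hsupp : ∀ r, Real.sqrt T < r → g r = 0) {c : ℝ} (hc0 : 0 ≤ c)
    (hlow : ∀ w : Space, w ≠ 0 → ‖w‖ ≤ Real.sqrt T →
      ENNReal.ofReal (c * ‖w‖⁻¹) ≤ ∫⁻ s in Ioc 0 T, ρ s ‖w‖) :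
    ENNReal.ofReal c * ∫⁻ w : Space, g ‖w‖ * ENNReal.ofReal (‖w‖⁻¹) ≤
      ∫⁻ ω, (∫⁻ s in Ioc 0 T, g ‖Z s.toNNReal ω‖) ∂P := by
  rw [lintegral_occupation_eq_space hZ hg hρ hlaw T,
    ← lintegral_const_mul' _ _ ENNReal.ofReal_ne_top]
  refine lintegral_mono fun w => ?_
  by_cases hw : w = 0
  · simp [hw]
  by_cases hwT : Real.sqrt T < ‖w‖
  · simp [hsupp _ hwT]
  rw [not_lt] at hwT
  calc ENNReal.ofReal c * (g ‖w‖ * ENNReal.ofReal ‖w‖⁻¹)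
      = g ‖w‖ * ENNReal.ofReal (c * ‖w‖⁻¹) := by
        rw [ENNReal.ofReal_mul hc0]
        ring
    _ ≤ g ‖w‖ * ∫⁻ s in Ioc 0 T, ρ s ‖w‖ := mul_le_mul_right (hlow w hw hwT) _


/-- **Upper bound on the first moment**: if `∫_{(0,∞)} ρ_s(|w|) ds ≤ C/|w|` for `w ≠ 0`, then
`E J ≤ C m`. [folklore] -/
theorem lintegral_occupation_le [SFinite P] (hZ : Measurable fun p : Ω × ℝ≥0 => Z p.2 p.1)
    (hg : Measurable g) (hρ : Measurable fun p : ℝ × ℝ => ρ p.1 p.2)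
    (hlaw : ∀ t : ℝ≥0, t ≠ 0 → ∀ F : Space → ℝ≥0∞, Measurable F →
      ∫⁻ ω, F (Z t ω) ∂P = ∫⁻ w, ρ t ‖w‖ * F w) (T : ℝ) {C : ℝ} (hC0 : 0 ≤ C)
    (hup : ∀ w : Space, w ≠ 0 → ∫⁻ s in Ioi (0 : ℝ), ρ s ‖w‖ ≤ ENNReal.ofReal (C * ‖w‖⁻¹)) :
    ∫⁻ ω, (∫⁻ s in Ioc 0 T, g ‖Z s.toNNReal ω‖) ∂P ≤
      ENNReal.ofReal C * ∫⁻ w : Space, g ‖w‖ * ENNReal.ofReal (‖w‖⁻¹) := by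
  rw [lintegral_occupation_eq_space hZ hg hρ hlaw T,
    ← lintegral_const_mul' _ _ ENNReal.ofReal_ne_top]
  refine lintegral_mono_ae ?_
  filter_upwards [ae_ne_zero_space] with w hw
  calc g ‖w‖ * ∫⁻ s in Ioc 0 T, ρ s ‖w‖ ≤ g ‖w‖ * ∫⁻ s in Ioi 0, ρ s ‖w‖ :=
        mul_le_mul_right (lintegral_mono_set Ioc_subset_Ioi_self) _
    _ ≤ g ‖w‖ * ENNReal.ofReal (C * ‖w‖⁻¹) := mul_le_mul_right (hup w hw) _
    _ = ENNReal.ofReal C * (g ‖w‖ * ENNReal.ofReal ‖w‖⁻¹) := by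
        rw [ENNReal.ofReal_mul hC0]
        ring


/-! ### Paley–Zygmund -/

/-- The real arithmetic of the Paley–Zygmund step: from `(E − A)² ≤ 2 C K M E p`, `c M ≤ E`,
`c ≥ 2/1000`, `C ≤ 125 c`, `M > 0`, `K ≥ 1`, conclude `p ≥ 1/(1000 K)`.
[folklore] -/
theorem pz_arith {E M K c C p : ℝ} (hM : 0 < M) (hK : 1 ≤ K) (hc : 2 / 1000 ≤ c)
    (hcC : C ≤ 125 * c) (hE : c * M ≤ E) (hp0 : 0 ≤ p)
    (hkey : (E - M / 1000) ^ 2 ≤ 2 * (C * (K * M)) * E * p) :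
    1 / (1000 * K) ≤ p := by
  have hc0 : 0 < c := by linarith
  have hE0 : 0 < E := lt_of_lt_of_le (mul_pos hc0 hM) hE
  have h1 : E / 2 ≤ E - M / 1000 := by nlinarith
  have h2 : (E / 2) ^ 2 ≤ (E - M / 1000) ^ 2 := pow_le_pow_left₀ (by positivity) h1 2
  have h3 : E * E ≤ E * (8 * C * K * M * p) := by nlinarith
  have h4 : E ≤ 8 * C * K * M * p := le_of_mul_le_mul_left h3 hE0
  have h5 : c * M ≤ (8 * C * K * p) * M := by nlinarith
  have h6 : c ≤ 8 * C * K * p := le_of_mul_le_mul_right h5 hM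
  have hKp : 0 ≤ K * p := mul_nonneg (by linarith) hp0
  have h7 : c * 1 ≤ c * (1000 * K * p) := by nlinarith
  have h8 : 1 ≤ 1000 * K * p := le_of_mul_le_mul_left h7 hc0
  rw [div_le_iff₀ (by positivity)]
  linarith

/-- **Occupation estimate from kernel bounds (second moment, Paley–Zygmund).** Let `Z` be a
jointly measurable `ℝ³`-valued process on a probability space with radial marginal densities
`ρ_t(|w|)` (`t > 0`) and the Markov factorisation `E[F(Z_s)H(Z_{s+τ})] = E[F(Z_s) E'[H(Z_s +
Z'_τ)]]`; let `g ≥ 0` be measurable with `g(r) = 0` for `r > √T`, `m = ∫ g(|w|)/|w| dw ∈ (0, ∞)`,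
`∫ g(|w|)/|w − x| dw ≤ K m` for a.e. `x` (`K ≥ 1`), and suppose the Green-function bounds
`c/|w| ≤ ∫_{(0,T]} ρ_s(|w|) ds` (`0 < |w| ≤ √T`), `∫_{(0,∞)} ρ_s(|w|) ds ≤ C/|w|` (`w ≠ 0`) with
`c ≥ 2/1000`, `0 ≤ C ≤ 125 c`. Then `P(∫_{(0,T]} g(|Z_s|) ds ≥ m/1000) ≥ 1/(1000 K)`:
`E J ≥ c m ≥ 2 m/1000`, `E[J²] ≤ 2 C K m E J`, and Paley–Zygmund
`P(J > a) ≥ (E J − a)²/E[J²] ≥ E J/(8 C K m) ≥ c/(8 C K)`. [folklore] -/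
theorem occupation_pz_of_kernel_bounds [IsProbabilityMeasure P]
    (hZ : Measurable fun p : Ω × ℝ≥0 => Z p.2 p.1) (hρ : Measurable fun p : ℝ × ℝ => ρ p.1 p.2)
    (hlaw : ∀ t : ℝ≥0, t ≠ 0 → ∀ F : Space → ℝ≥0∞, Measurable F →
      ∫⁻ ω, F (Z t ω) ∂P = ∫⁻ w, ρ t ‖w‖ * F w)
    (hmarkov : ∀ (s τ : ℝ≥0) (F H : Space → ℝ≥0∞), Measurable F → Measurable H →
      ∫⁻ ω, F (Z s ω) * H (Z (s + τ) ω) ∂P = ∫⁻ ω, F (Z s ω) * ∫⁻ ω', H (Z s ω + Z τ ω') ∂P ∂P)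
    {T : ℝ} (hg : Measurable g) (hsupp : ∀ r, Real.sqrt T < r → g r = 0) {m : ℝ≥0∞}
    (hm0 : m ≠ 0) (hmT : m ≠ ⊤) (hm : m = ∫⁻ w : Space, g ‖w‖ * ENNReal.ofReal (‖w‖⁻¹))
    {K : ℝ} (hK : 1 ≤ K)
    (hpot : ∀ᵐ x : Space, ∫⁻ w : Space, g ‖w‖ * ENNReal.ofReal (‖w - x‖⁻¹) ≤ ENNReal.ofReal K * m)
    {c C : ℝ} (hc : 2 / 1000 ≤ c) (hC0 : 0 ≤ C) (hcC : C ≤ 125 * c)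
    (hlow : ∀ w : Space, w ≠ 0 → ‖w‖ ≤ Real.sqrt T →
      ENNReal.ofReal (c * ‖w‖⁻¹) ≤ ∫⁻ s in Ioc 0 T, ρ s ‖w‖)
    (hup : ∀ w : Space, w ≠ 0 → ∫⁻ s in Ioi (0 : ℝ), ρ s ‖w‖ ≤ ENNReal.ofReal (C * ‖w‖⁻¹)) :
    ENNReal.ofReal (1 / (1000 * K)) ≤
      P {ω | m / 1000 ≤ ∫⁻ s in Ioc 0 T, g ‖Z s.toNNReal ω‖} := by
  have hc0 : 0 ≤ c := le_trans (by norm_num) hc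
  have hK0 : 0 ≤ K := le_trans zero_le_one hK
  set J : Ω → ℝ≥0∞ := fun ω => ∫⁻ s in Ioc 0 T, g ‖Z s.toNNReal ω‖ with hJ
  have hJm : Measurable J := measurable_occupation hZ hg T
  set B : ℝ≥0∞ := ENNReal.ofReal C * (ENNReal.ofReal K * m) with hB
  -- moments
  have he_low : ENNReal.ofReal c * m ≤ ∫⁻ ω, J ω ∂P := by
    have h := lintegral_occupation_ge (P := P) hZ hg hρ hlaw hsupp hc0 hlow
    rwa [← hm] at h
  have he_up : ∫⁻ ω, J ω ∂P ≤ ENNReal.ofReal C * m := by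
    have h := lintegral_occupation_le (P := P) hZ hg hρ hlaw T hC0 hup
    rwa [← hm] at h
  have hq : ∫⁻ ω, J ω ^ 2 ∂P ≤ 2 * B * ∫⁻ ω, J ω ∂P :=
    lintegral_occupation_sq_le hZ hg hρ hlaw hmarkov hC0 hup hmT hpot T
  -- Paley–Zygmund
  have hPZ := Literature.Probability.Moments.paleyZygmund (P := P) hJm.aemeasurable (m / 1000)
  have hmono : P {ω | m / 1000 < J ω} ≤ P {ω | m / 1000 ≤ J ω} :=
    measure_mono fun ω hω => le_of_lt (show m / 1000 < J ω from hω)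
  have key : (∫⁻ ω, J ω ∂P - m / 1000) ^ 2 ≤ 2 * B * (∫⁻ ω, J ω ∂P) * P {ω | m / 1000 ≤ J ω} :=
    hPZ.trans (mul_le_mul' hq hmono)
  -- finiteness and passage to real numbers
  have he_top : ∫⁻ ω, J ω ∂P ≠ ⊤ :=
    ne_top_of_le_ne_top (ENNReal.mul_ne_top ENNReal.ofReal_ne_top hmT) he_up
  have hp_top : P {ω | m / 1000 ≤ J ω} ≠ ⊤ := measure_ne_top _ _
  have ha_top : m / 1000 ≠ ⊤ := ENNReal.div_ne_top hmT (by norm_num)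
  have hM : 0 < m.toReal := ENNReal.toReal_pos hm0 hmT
  have hA : (m / 1000).toReal = m.toReal / 1000 := by
    rw [ENNReal.toReal_div]
    norm_num
  have hE : c * m.toReal ≤ (∫⁻ ω, J ω ∂P).toReal := by
    have h := ENNReal.toReal_mono he_top he_low
    rwa [ENNReal.toReal_mul, ENNReal.toReal_ofReal hc0] at h
  have ha_le : m / 1000 ≤ ∫⁻ ω, J ω ∂P := by
    rw [← ENNReal.toReal_le_toReal ha_top he_top, hA]
    nlinarith
  have hkeyR : ((∫⁻ ω, J ω ∂P).toReal - m.toReal / 1000) ^ 2 ≤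
      2 * (C * (K * m.toReal)) * (∫⁻ ω, J ω ∂P).toReal * (P {ω | m / 1000 ≤ J ω}).toReal := by
    have h := ENNReal.toReal_mono (ENNReal.mul_ne_top (ENNReal.mul_ne_top
      (ENNReal.mul_ne_top ENNReal.ofNat_ne_top ?_) he_top) hp_top) key
    · rwa [ENNReal.toReal_pow, ENNReal.toReal_sub_of_le ha_le he_top, hA, ENNReal.toReal_mul,
        ENNReal.toReal_mul, ENNReal.toReal_mul, ENNReal.toReal_ofNat, hB, ENNReal.toReal_mul,
        ENNReal.toReal_mul, ENNReal.toReal_ofReal hC0, ENNReal.toReal_ofReal hK0] at h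
    · exact ENNReal.mul_ne_top ENNReal.ofReal_ne_top
        (ENNReal.mul_ne_top ENNReal.ofReal_ne_top hmT)
  have hfin := pz_arith hM hK hc hcC hE ENNReal.toReal_nonneg hkeyR
  exact (ENNReal.ofReal_le_iff_le_toReal hp_top).2 hfin


end Abstract

/-! ### (S8) The stub -/

/-- **(S8)** Let `i ≠ j`, `xᵢ = xⱼ`, `T > 0`, `g : ℝ → [0,∞]` measurable with `g(r) = 0` for
`r > √T`, `m = ∫ g(|w|)/|w| dw ∈ (0, ∞)`, and suppose the potential bound
`∫ g(|w|)/|w − x| dw ≤ K m` for a.e. `x` (`K ≥ 1`). Then the occupation functional of the pair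
distance satisfies `P(∫₀ᵀ g(|Bⁱ_s − Bʲ_s|) ds ≥ m/1000) ≥ 1/(1000 K)` (Green function of the pair
motion `≍ 1/|w|` on `|w| ≤ √T`, second moment, Paley–Zygmund). [folklore] -/
theorem stub_threeDim_occupation_pz {N : ℕ} {X : Config N} {i j : Fin N} (hij : i ≠ j)
    (hX : X i = X j) {T : ℝ} (hT : 0 < T) {g : ℝ → ℝ≥0∞} (hg : Measurable g)
    (hsupp : ∀ r, Real.sqrt T < r → g r = 0) {m : ℝ≥0∞} (hm0 : m ≠ 0) (hmT : m ≠ ⊤)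
    (hm : m = ∫⁻ w : Space, g ‖w‖ * ENNReal.ofReal (‖w‖⁻¹)) {K : ℝ} (hK : 1 ≤ K)
    (hpot : ∀ᵐ x : Space, ∫⁻ w : Space, g ‖w‖ * ENNReal.ofReal (‖w - x‖⁻¹) ≤ ENNReal.ofReal K * m) :
    ENNReal.ofReal (1 / (1000 * K)) ≤
      wienerPaths N {ω | m / 1000 ≤
        ∫⁻ s in Set.Ioc 0 T, g (dist (worldLine X ω s.toNNReal i) (worldLine X ω s.toNNReal j))} := by
  simp_rw [dist_eq_norm]
  obtain ⟨hc, hcC⟩ := green_consts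
  refine occupation_pz_of_kernel_bounds (P := wienerPaths N)
    (Z := fun t ω => worldLine X ω t i - worldLine X ω t j)
    (ρ := fun t r => ENNReal.ofReal
      ((Real.sqrt (8 * Real.pi * t))⁻¹ ^ 3 * Real.exp (-r ^ 2 / (8 * t))))
    (measurable_pairDiff_uncurry X i j) measurable_heatProfile
    (fun t ht F hF => lintegral_pairDiff_eq hij hX ht hF)
    (fun s τ F H hF hH => lintegral_pairDiff_mul_shift hX s τ hF hH)
    hg hsupp hm0 hmT hm hK hpot hc (by positivity) hcC (fun w hw hwT => ?_) (fun w hw => ?_)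
  · have hr : 0 < ‖w‖ := norm_pos_iff.2 hw
    have hrT : ‖w‖ ^ 2 ≤ T := (pow_le_pow_left₀ (norm_nonneg w) hwT 2).trans_eq (Real.sq_sqrt hT.le)
    exact green_lower hr hrT
  · exact green_upper (norm_pos_iff.2 hw)

end Summit.AtomisticToContinuum.BoseEinsteinCondensation.Theorems.CutLineWitness

end
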